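import Literature.Topology.FourManifolds.CircleNormalFraming
import Mathlib.Analysis.InnerProductSpace.PiL2
import Mathlib.Geometry.Manifold.IsManifold.Basic
import Mathlib.Geometry.Manifold.Instances.Real
import HarnessLib

/-!
# Vector bundles as smooth fields of projections: the total space as a manifold

Topic `Literature/Topology/Immersions`. A rank-`k` real vector bundle over an `n`-manifold `M`
*inside the trivial bundle* `M × ℝᵐ` is recorded, as everywhere in this tree (tangent planes of an
immersion `Literature.Topology.FourManifolds.tangentProj`, normal planes
`Literature.Topology.FourManifolds.norProj`, …), by a **smooth field of orthogonal projections**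
`P : M → (ℝᵐ →L ℝᵐ)`, `P_x² = P_x = P_xᵀ`, `rank P_x = k` (`ProjBundle`); its fibre is
`E_x = range P_x` (Milnor–Stasheff, *Characteristic Classes* (1974), §3, Thm. 3.3 / §5: sub-bundles
of a trivial bundle and their orthogonal complements; every bundle over a compact base embeds in a
trivial one). This file makes the **total space**

  `E(P) = {(x, v) ∈ M × ℝᵐ | P_x v = v}`

a Hausdorff, second countable `C^∞` manifold (`ProjBundle.Total`, charted on `ℝⁿ × ℝᵏ` with the
self-model `𝓘(ℝ, ℝⁿ × ℝᵏ)`): over the domain of the chart `φ` of `M` at `x₀`, shrunk to where the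
transported frame `A_x = P_x ∘ B` (`B : ℝᵏ →L ℝᵐ` a fixed parametrisation of `E_{x₀}`) stays
injective, the bundle chart is `(x, v) ↦ (φ x, (A_xᵀ A_x)⁻¹ A_xᵀ v)` with inverse
`(u, c) ↦ (φ⁻¹ u, A_{φ⁻¹ u} c)` (`ProjBundle.bchart`); the chart changes are `C^∞` because `x ↦ A_x`
is (`ProjBundle.isManifold`, Hirsch, *Differential Topology* (1976), Ch. 4 §1, the vector bundle
structure from local frames). The inclusion `E(P) → M × ℝᵐ`, the projection `E(P) → M`, the zero
section and the fibrewise-linear retraction `(y, w) ↦ (y, P_y w) : M × ℝᵐ → E(P)` are `C^∞`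
(`ProjBundle.contMDiff_incl`, `ProjBundle.contMDiff_base`, `ProjBundle.contMDiff_zero`,
`ProjBundle.contMDiff_retr`).

This is the carrier for the tree's Phillips-based immersion theorems with a prescribed (possibly
non-trivial) normal bundle (`HirschImmersionTwisted.lean`). We do not use Mathlib's abstract
`VectorBundle`/`Bundle.TotalSpace` API: what those theorems need is precisely that `E(P)` sits
inside `M × ℝᵐ` with the smooth retraction `retr`, so that tangent vectors of `E(P)` are pushed
and detected through `M × ℝᵐ` (no vector-bundle charts of `T E(P)` are ever computed); the bundle
projection is called `base` (not `π`, which is a token once `Bundle` is opened).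

Everything here is proved; no named facts are introduced (D-0026).

## References

* J. Milnor, J. Stasheff, *Characteristic Classes*, Ann. of Math. Studies 76 (1974), §2–§3
  (sub-bundles, Thm. 3.3), §5. [MilnorStasheff1974]
* M. W. Hirsch, *Differential Topology*, GTM 33 (1976), Ch. 4 §1 (vector bundles, local
  trivialisations) and §2 (sub-bundles of trivial bundles). [HirschDT1976]
-/

open scoped Manifold ContDiff Topology RealInnerProductSpace
open Set Function Module

noncomputable section

namespace Literature.Topology.Immersions

/-- Local notation: `𝔼 n` is the model Euclidean space `EuclideanSpace ℝ (Fin n)`. -/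
local notation "𝔼 " n:arg => EuclideanSpace ℝ (Fin n)

open Literature.Topology.FourManifolds (gramOp gramProj leftInv leftInv_apply_self self_leftInv_apply
  apply_leftInv_of_mem_range contDiffAt_leftInv)

/-! ### Smooth fields of orthogonal projections -/

variable {n m k : ℕ}

/-- A **rank-`k` vector bundle over `M` inside `M × ℝᵐ`, as a smooth field of orthogonal
projections**: `P_x` is a self-adjoint idempotent of `ℝᵐ` of rank `k` depending `C^∞` on `x`; the
fibre over `x` is `E_x = range P_x` (Milnor–Stasheff §3: sub-bundles of the trivial bundle).
[cite: MilnorStasheff1974, §3 Thm. 3.3] -/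
structure ProjBundle (n m k : ℕ) (M : Type*) [TopologicalSpace M] [ChartedSpace (𝔼 n) M] where
  /-- The field of projections. -/
  proj : M → 𝔼 m →L[ℝ] 𝔼 m
  /-- The field is `C^∞`. -/
  contMDiff_proj' : ContMDiff (𝓡 n) 𝓘(ℝ, 𝔼 m →L[ℝ] 𝔼 m) ∞ proj
  /-- Each `P_x` is idempotent. -/
  proj_proj : ∀ x v, proj x (proj x v) = proj x v
  /-- Each `P_x` is self-adjoint. -/
  inner_proj_comm : ∀ x v w, ⟪proj x v, w⟫ = ⟪v, proj x w⟫
  /-- Each `P_x` has rank `k`. -/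
  finrank_range : ∀ x, finrank ℝ (LinearMap.range (proj x).toLinearMap) = k

namespace ProjBundle

variable {M : Type*} [TopologicalSpace M] [ChartedSpace (𝔼 n) M] (P : ProjBundle n m k M)

/-- The **fibre** `E_x = range P_x`. [folklore] -/
def fibre (x : M) : Submodule ℝ (𝔼 m) := LinearMap.range (P.proj x).toLinearMap

/-- `v ∈ E_x ↔ P_x v = v`. [folklore] -/
theorem mem_fibre_iff {x : M} {v : 𝔼 m} : v ∈ P.fibre x ↔ P.proj x v = v := by
  constructor
  · rintro ⟨u, rfl⟩
    exact P.proj_proj x u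
  · intro h
    exact ⟨v, h⟩

/-- `P_x v ∈ E_x`. [folklore] -/
theorem proj_mem_fibre (x : M) (v : 𝔼 m) : P.proj x v ∈ P.fibre x := ⟨v, rfl⟩

/-- The field of projections is continuous. [folklore] -/
theorem continuous_proj : Continuous P.proj := P.contMDiff_proj'.continuous

/-! ### The total space -/

/-- The **total space** `E(P) = {(x, v) | P_x v = v} ⊆ M × ℝᵐ`. [folklore] -/
def Total : Type _ := {p : M × 𝔼 m // P.proj p.1 p.2 = p.2}

/-- The inclusion `E(P) → M × ℝᵐ`. [folklore] -/
def incl (p : P.Total) : M × 𝔼 m := p.1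

/-- The bundle projection `E(P) → M`. [folklore] -/
def base (p : P.Total) : M := p.1.1

/-- The vector of a point of the total space. [folklore] -/
def vec (p : P.Total) : 𝔼 m := p.1.2

/-- Points of the total space are fixed by the projection. [folklore] -/
theorem proj_vec (p : P.Total) : P.proj (P.base p) (P.vec p) = P.vec p := p.2

/-- The vector of a point lies in the fibre. [folklore] -/
theorem vec_mem_fibre (p : P.Total) : P.vec p ∈ P.fibre (P.base p) := P.mem_fibre_iff.2 (P.proj_vec p)

/-- Extensionality for points of the total space. [folklore] -/
@[ext] theorem Total.ext {p q : P.Total} (h1 : P.base p = P.base q) (h2 : P.vec p = P.vec q) : p = q :=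
  Subtype.ext (Prod.ext h1 h2)

/-- The **zero section**. [folklore] -/
def zero (x : M) : P.Total := ⟨(x, 0), by simp⟩

/-- The zero section lies over its argument. [folklore] -/
@[simp] theorem base_zero (x : M) : P.base (P.zero x) = x := rfl

/-- The zero section has zero vector. [folklore] -/
@[simp] theorem vec_zero (x : M) : P.vec (P.zero x) = 0 := rfl

/-- The **fibrewise-linear retraction** `(y, w) ↦ (y, P_y w) : M × ℝᵐ → E(P)`. [folklore] -/
def retr (q : M × 𝔼 m) : P.Total := ⟨(q.1, P.proj q.1 q.2), P.proj_proj q.1 q.2⟩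

/-- The retraction preserves base points. [folklore] -/
@[simp] theorem base_retr (q : M × 𝔼 m) : P.base (P.retr q) = q.1 := rfl

/-- The vector of the retraction is `P_y w`. [folklore] -/
@[simp] theorem vec_retr (q : M × 𝔼 m) : P.vec (P.retr q) = P.proj q.1 q.2 := rfl

/-- The retraction is the identity on the total space. [folklore] -/
theorem retr_incl (p : P.Total) : P.retr (P.incl p) = p :=
  Total.ext P rfl (P.proj_vec p)

/-- The zero section is the retraction of `x ↦ (x, 0)`. [folklore] -/
theorem zero_eq_retr_comp : P.zero = P.retr ∘ fun x => (x, (0 : 𝔼 m)) := by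
  funext x
  exact Total.ext P rfl (by simp)

/-- The topology of the total space: the subspace topology of `M × ℝᵐ`. [folklore] -/
instance : TopologicalSpace P.Total := instTopologicalSpaceSubtype

/-- The inclusion is continuous. [folklore] -/
theorem continuous_incl : Continuous P.incl := continuous_subtype_val

/-- The bundle projection is continuous. [folklore] -/
theorem continuous_base : Continuous P.base := continuous_fst.comp P.continuous_incl

/-- The vector part is continuous. [folklore] -/
theorem continuous_vec : Continuous P.vec := continuous_snd.comp P.continuous_incl

/-- The inclusion is a topological embedding. [folklore] -/
theorem isEmbedding_incl : Topology.IsEmbedding P.incl := Topology.IsEmbedding.subtypeVal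

/-- The zero section is continuous. [folklore] -/
theorem continuous_zero : Continuous P.zero :=
  Continuous.subtype_mk (continuous_id.prodMk continuous_const) _

/-- The retraction is continuous. [folklore] -/
theorem continuous_retr : Continuous P.retr :=
  Continuous.subtype_mk (continuous_fst.prodMk
    ((P.continuous_proj.comp continuous_fst).clm_apply continuous_snd)) _

/-- The total space over a Hausdorff base is Hausdorff. [folklore] -/
instance [T2Space M] : T2Space P.Total := P.isEmbedding_incl.t2Space

/-- The total space over a second countable base is second countable. [folklore] -/
instance [SecondCountableTopology M] : SecondCountableTopology P.Total :=
  P.isEmbedding_incl.secondCountableTopology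

/-! ### Local frames and bundle charts -/

/-- A **parametrisation of the fibre at `x₀`**: an injective `B : ℝᵏ →L ℝᵐ` with range `E_{x₀}`
(from a basis of the `k`-dimensional fibre). [folklore] -/
theorem exists_fibreParam (x₀ : M) :
    ∃ B : 𝔼 k →L[ℝ] 𝔼 m, Injective B ∧ LinearMap.range B.toLinearMap = P.fibre x₀ := by
  have hk : finrank ℝ (P.fibre x₀) = k := P.finrank_range x₀
  let b : Basis (Fin k) ℝ (P.fibre x₀) := Module.finBasisOfFinrankEq ℝ (P.fibre x₀) hk
  let L : 𝔼 k →ₗ[ℝ] 𝔼 m := (P.fibre x₀).subtype ∘ₗ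
    (b.equivFun.symm.toLinearMap ∘ₗ (EuclideanSpace.equiv (Fin k) ℝ).toLinearMap)
  refine ⟨LinearMap.toContinuousLinearMap L, ?_, ?_⟩
  · change Injective L
    exact (P.fibre x₀).injective_subtype.comp
      (b.equivFun.symm.injective.comp (EuclideanSpace.equiv (Fin k) ℝ).injective)
  · change LinearMap.range L = P.fibre x₀
    rw [LinearMap.range_comp, LinearMap.range_eq_top.2, Submodule.map_top, Submodule.range_subtype]
    exact b.equivFun.symm.surjective.comp (EuclideanSpace.equiv (Fin k) ℝ).surjective

/-- A chosen parametrisation `B_{x₀}` of the fibre at `x₀`. [folklore] -/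
def fibreParam (x₀ : M) : 𝔼 k →L[ℝ] 𝔼 m := (P.exists_fibreParam x₀).choose

/-- The chosen parametrisation is injective. [folklore] -/
theorem injective_fibreParam (x₀ : M) : Injective (P.fibreParam x₀) :=
  (P.exists_fibreParam x₀).choose_spec.1

/-- The chosen parametrisation has range the fibre. [folklore] -/
theorem range_fibreParam (x₀ : M) :
    LinearMap.range (P.fibreParam x₀).toLinearMap = P.fibre x₀ :=
  (P.exists_fibreParam x₀).choose_spec.2

/-- The **transported frame** `A_x = P_x ∘ B_{x₀} : ℝᵏ →L ℝᵐ`: a parametrisation of `E_x` for `x`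
near `x₀`, depending `C^∞` on `x`. [folklore] -/
def frameAt (x₀ x : M) : 𝔼 k →L[ℝ] 𝔼 m := (P.proj x).comp (P.fibreParam x₀)

/-- Unfolding of the transported frame. [folklore] -/
theorem frameAt_apply (x₀ x : M) (c : 𝔼 k) : P.frameAt x₀ x c = P.proj x (P.fibreParam x₀ c) := rfl

/-- At the base point the transported frame is the parametrisation. [folklore] -/
theorem frameAt_self (x₀ : M) : P.frameAt x₀ x₀ = P.fibreParam x₀ := by
  ext1 c
  rw [frameAt_apply]
  exact P.mem_fibre_iff.1 (P.range_fibreParam x₀ ▸ ⟨c, rfl⟩)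

/-- Values of the transported frame lie in the fibre. [folklore] -/
theorem frameAt_apply_mem (x₀ x : M) (c : 𝔼 k) : P.frameAt x₀ x c ∈ P.fibre x :=
  P.proj_mem_fibre x _

/-- `x ↦ A_x` is `C^∞`. [folklore] -/
theorem contMDiff_frameAt (x₀ : M) :
    ContMDiff (𝓡 n) 𝓘(ℝ, 𝔼 k →L[ℝ] 𝔼 m) ∞ (P.frameAt x₀) :=
  P.contMDiff_proj'.clm_comp contMDiff_const

/-- `x ↦ A_x` is continuous. [folklore] -/
theorem continuous_frameAt (x₀ : M) : Continuous (P.frameAt x₀) := (P.contMDiff_frameAt x₀).continuous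

/-- The **good set** of the base point `x₀`: the part of the chart domain of `x₀` where the
transported frame is injective. [folklore] -/
def goodSet (x₀ : M) : Set M := (chartAt (𝔼 n) x₀).source ∩ {x | Injective (P.frameAt x₀ x)}

/-- The good set lies in the chart domain. [folklore] -/
theorem goodSet_subset_source (x₀ : M) : P.goodSet x₀ ⊆ (chartAt (𝔼 n) x₀).source := inter_subset_left

/-- On the good set the transported frame is injective. [folklore] -/
theorem injective_frameAt_of_mem {x₀ x : M} (hx : x ∈ P.goodSet x₀) : Injective (P.frameAt x₀ x) := hx.2

/-- Injectivity of a continuous family of linear maps on a finite-dimensional space is an open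
condition. [folklore] -/
theorem isOpen_setOf_injective_frameAt (x₀ : M) : IsOpen {x | Injective (P.frameAt x₀ x)} := by
  have h : {x | Injective (P.frameAt x₀ x)} = (fun x => fun j : Fin k =>
      P.frameAt x₀ x (EuclideanSpace.single j 1)) ⁻¹' {v | LinearIndependent ℝ v} := by
    ext x
    simp only [mem_setOf_eq, mem_preimage]
    constructor
    · intro hinj
      have hb := (EuclideanSpace.basisFun (Fin k) ℝ).toBasis.linearIndependent
      have := hb.map' (P.frameAt x₀ x : 𝔼 k →ₗ[ℝ] 𝔼 m) (LinearMap.ker_eq_bot.2 hinj)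
      simpa [Function.comp_def] using this
    · intro hli
      refine (injective_iff_map_eq_zero _).2 fun c hc => ?_
      have hc' : ∑ j, c j • P.frameAt x₀ x (EuclideanSpace.single j 1) = 0 := by
        have : c = ∑ j, c j • EuclideanSpace.single j (1 : ℝ) := by
          simpa using ((EuclideanSpace.basisFun (Fin k) ℝ).sum_repr c).symm
        rw [this, map_sum] at hc
        simpa [map_smul] using hc
      have h0 := Fintype.linearIndependent_iff.1 hli (fun j => c j) hc'
      ext j
      exact h0 j
  rw [h]
  refine IsOpen.preimage ?_ isOpen_setOf_linearIndependent
  exact continuous_pi fun j => (P.continuous_frameAt x₀).clm_apply continuous_const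

/-- The good set is open. [folklore] -/
theorem isOpen_goodSet (x₀ : M) : IsOpen (P.goodSet x₀) :=
  (chartAt (𝔼 n) x₀).open_source.inter (P.isOpen_setOf_injective_frameAt x₀)

/-- The base point lies in its good set. [folklore] -/
theorem mem_goodSet_self (x₀ : M) : x₀ ∈ P.goodSet x₀ :=
  ⟨mem_chart_source _ x₀, by rw [mem_setOf_eq, frameAt_self]; exact P.injective_fibreParam x₀⟩

/-- On the good set the transported frame parametrises the fibre. [folklore] -/
theorem range_frameAt_of_mem {x₀ x : M} (hx : x ∈ P.goodSet x₀) :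
    LinearMap.range (P.frameAt x₀ x).toLinearMap = P.fibre x := by
  apply Submodule.eq_of_le_of_finrank_eq
  · rintro _ ⟨c, rfl⟩
    exact P.frameAt_apply_mem x₀ x c
  · rw [LinearMap.finrank_range_of_inj hx.2, finrank_euclideanSpace_fin]
    exact (P.finrank_range x).symm

/-- **The bundle chart at `x₀`**: `(x, v) ↦ (φ x, leftInv A_x v)` with inverse
`(u, c) ↦ (φ⁻¹ u, A_{φ⁻¹ u} c)` (Hirsch, Ch. 4 §1: the local trivialisation from a local frame).
[cite: HirschDT1976, Ch. 4 §1] -/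
def bchart (x₀ : M) : OpenPartialHomeomorph P.Total (𝔼 n × 𝔼 k) where
  toFun p := (chartAt (𝔼 n) x₀ (P.base p), leftInv (P.frameAt x₀ (P.base p)) (P.vec p))
  invFun q := ⟨((chartAt (𝔼 n) x₀).symm q.1, P.frameAt x₀ ((chartAt (𝔼 n) x₀).symm q.1) q.2),
    P.mem_fibre_iff.1 (P.frameAt_apply_mem x₀ _ q.2)⟩
  source := P.base ⁻¹' P.goodSet x₀
  target := {q | q.1 ∈ (chartAt (𝔼 n) x₀).target ∧ (chartAt (𝔼 n) x₀).symm q.1 ∈ P.goodSet x₀}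
  map_source' p hp := by
    refine ⟨(chartAt (𝔼 n) x₀).map_source hp.1, ?_⟩
    change (chartAt (𝔼 n) x₀).symm (chartAt (𝔼 n) x₀ (P.base p)) ∈ P.goodSet x₀
    rwa [(chartAt (𝔼 n) x₀).left_inv hp.1]
  map_target' q hq := hq.2
  left_inv' p hp := by
    have hx : (chartAt (𝔼 n) x₀).symm (chartAt (𝔼 n) x₀ (P.base p)) = P.base p :=
      (chartAt (𝔼 n) x₀).left_inv hp.1
    refine Total.ext P ?_ ?_
    · exact hx
    · change P.frameAt x₀ ((chartAt (𝔼 n) x₀).symm (chartAt (𝔼 n) x₀ (P.base p)))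
        (leftInv (P.frameAt x₀ (P.base p)) (P.vec p)) = P.vec p
      rw [hx]
      exact apply_leftInv_of_mem_range hp.2 (P.range_frameAt_of_mem hp ▸ P.vec_mem_fibre p)
  right_inv' q hq := by
    obtain ⟨hq1, hq2⟩ := hq
    refine Prod.ext ?_ ?_
    · exact (chartAt (𝔼 n) x₀).right_inv hq1
    · change leftInv (P.frameAt x₀ ((chartAt (𝔼 n) x₀).symm q.1))
        (P.frameAt x₀ ((chartAt (𝔼 n) x₀).symm q.1) q.2) = q.2
      exact leftInv_apply_self hq2.2 q.2
  open_source := (P.isOpen_goodSet x₀).preimage P.continuous_base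
  open_target := by
    have h1 : IsOpen ((chartAt (𝔼 n) x₀).target ∩ (chartAt (𝔼 n) x₀).symm ⁻¹' P.goodSet x₀) :=
      (chartAt (𝔼 n) x₀).isOpen_inter_preimage_symm (P.isOpen_goodSet x₀)
    exact h1.preimage continuous_fst
  continuousOn_toFun := by
    refine continuousOn_iff_continuous_restrict.2 ?_
    refine ((chartAt (𝔼 n) x₀).continuousOn.comp_continuous (P.continuous_base.comp
      continuous_subtype_val) fun p => p.2.1).prodMk ?_
    have hG : ContinuousOn (fun x => leftInv (P.frameAt x₀ x)) (P.goodSet x₀) := fun x hx =>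
      ((contDiffAt_leftInv hx.2).continuousAt.comp (P.continuous_frameAt x₀).continuousAt)
        |>.continuousWithinAt
    have h1 : Continuous fun p : (P.base ⁻¹' P.goodSet x₀ : Set P.Total) =>
        leftInv (P.frameAt x₀ (P.base p.1)) :=
      hG.comp_continuous (P.continuous_base.comp continuous_subtype_val) fun p => p.2
    exact h1.clm_apply (P.continuous_vec.comp continuous_subtype_val)
  continuousOn_invFun := by
    rw [P.isEmbedding_incl.isInducing.continuousOn_iff]
    have hsymm : ContinuousOn (fun q : 𝔼 n × 𝔼 k => (chartAt (𝔼 n) x₀).symm q.1)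
        {q : 𝔼 n × 𝔼 k | q.1 ∈ (chartAt (𝔼 n) x₀).target ∧
          (chartAt (𝔼 n) x₀).symm q.1 ∈ P.goodSet x₀} :=
      (chartAt (𝔼 n) x₀).continuousOn_symm.comp continuousOn_fst fun q hq => hq.1
    exact hsymm.prodMk (((P.continuous_frameAt x₀).comp_continuousOn hsymm).clm_apply
      continuousOn_snd)

/-- Unfolding of the bundle chart. [folklore] -/
@[simp] theorem bchart_apply (x₀ : M) (p : P.Total) :
    P.bchart x₀ p = (chartAt (𝔼 n) x₀ (P.base p), leftInv (P.frameAt x₀ (P.base p)) (P.vec p)) := rfl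

/-- The source of the bundle chart. [folklore] -/
theorem bchart_source (x₀ : M) : (P.bchart x₀).source = P.base ⁻¹' P.goodSet x₀ := rfl

/-- The target of the bundle chart. [folklore] -/
theorem bchart_target (x₀ : M) : (P.bchart x₀).target =
    {q | q.1 ∈ (chartAt (𝔼 n) x₀).target ∧ (chartAt (𝔼 n) x₀).symm q.1 ∈ P.goodSet x₀} := rfl

/-! ### The total space as a charted space -/

/-- **`E(P)` is charted on `ℝⁿ × ℝᵏ`** by the bundle charts. [cite: HirschDT1976, Ch. 4 §1] -/
instance chartedSpace : ChartedSpace (𝔼 n × 𝔼 k) P.Total where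
  atlas := range P.bchart
  chartAt p := P.bchart (P.base p)
  mem_chart_source p := P.mem_goodSet_self (P.base p)
  chart_mem_atlas _ := mem_range_self _

/-- The preferred chart at `p` is the bundle chart at `base p`. [folklore] -/
theorem chartAt_eq (p : P.Total) : chartAt (𝔼 n × 𝔼 k) p = P.bchart (P.base p) := rfl

/-- The **local parametrisation** `Φ_{x₀} (u, c) = (φ⁻¹ u, A_{φ⁻¹ u} c)` of `E(P) ⊆ M × ℝᵐ` over
the chart `φ` at `x₀` (`= incl ∘ (bchart x₀)⁻¹`). [folklore] -/
def localParam (x₀ : M) (q : 𝔼 n × 𝔼 k) : M × 𝔼 m :=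
  ((chartAt (𝔼 n) x₀).symm q.1, P.frameAt x₀ ((chartAt (𝔼 n) x₀).symm q.1) q.2)

/-- `incl ∘ (bchart x₀)⁻¹ = Φ_{x₀}`. [folklore] -/
theorem incl_bchart_symm (x₀ : M) (q : 𝔼 n × 𝔼 k) :
    P.incl ((P.bchart x₀).symm q) = P.localParam x₀ q := rfl

/-- `Φ_{x₀}` is `C^∞` over the chart target. [folklore] -/
theorem contMDiffOn_localParam [IsManifold (𝓡 n) ∞ M] (x₀ : M) :
    ContMDiffOn 𝓘(ℝ, 𝔼 n × 𝔼 k) ((𝓡 n).prod (𝓡 m)) ∞ (P.localParam x₀)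
      (Prod.fst ⁻¹' (chartAt (𝔼 n) x₀).target) := by
  have h1 : ContMDiffOn 𝓘(ℝ, 𝔼 n × 𝔼 k) (𝓡 n) ∞
      (fun q : 𝔼 n × 𝔼 k => (chartAt (𝔼 n) x₀).symm q.1) (Prod.fst ⁻¹' (chartAt (𝔼 n) x₀).target) :=
    (contMDiffOn_chart_symm (x := x₀)).comp contDiff_fst.contMDiff.contMDiffOn fun _ hq => hq
  have h2 : ContMDiffOn 𝓘(ℝ, 𝔼 n × 𝔼 k) 𝓘(ℝ, 𝔼 k →L[ℝ] 𝔼 m) ∞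
      (fun q : 𝔼 n × 𝔼 k => P.frameAt x₀ ((chartAt (𝔼 n) x₀).symm q.1))
      (Prod.fst ⁻¹' (chartAt (𝔼 n) x₀).target) :=
    (P.contMDiff_frameAt x₀).comp_contMDiffOn h1
  exact h1.prodMk (h2.clm_apply contDiff_snd.contMDiff.contMDiffOn)

/-- `leftInv A_y (P_y w) = leftInv A_y w` for the frame `A_y = P_y ∘ B` (`A_yᵀ P_y = A_yᵀ`).
[folklore] -/
theorem leftInv_frameAt_proj (x₁ y : M) (w : 𝔼 m) :
    leftInv (P.frameAt x₁ y) (P.proj y w) = leftInv (P.frameAt x₁ y) w := by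
  change (gramOp (P.frameAt x₁ y)).inverse (ContinuousLinearMap.adjoint (P.frameAt x₁ y)
    (P.proj y w)) = (gramOp (P.frameAt x₁ y)).inverse
      (ContinuousLinearMap.adjoint (P.frameAt x₁ y) w)
  congr 1
  refine ext_inner_right ℝ fun c => ?_
  rw [ContinuousLinearMap.adjoint_inner_left, ContinuousLinearMap.adjoint_inner_left,
    frameAt_apply, P.inner_proj_comm, P.proj_proj]

/-- The **local chart map** `Ψ_{x₁} (y, w) = (φ₁ y, leftInv A_y w)` on `M × ℝᵐ`
(`bchart x₁ = Ψ_{x₁} ∘ incl`, `bchart x₁ ∘ retr = Ψ_{x₁}`). [folklore] -/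
def localChart (x₁ : M) (q : M × 𝔼 m) : 𝔼 n × 𝔼 k :=
  (chartAt (𝔼 n) x₁ q.1, leftInv (P.frameAt x₁ q.1) q.2)

/-- `bchart x₁ ∘ retr = Ψ_{x₁}`. [folklore] -/
theorem bchart_retr (x₁ : M) (q : M × 𝔼 m) : P.bchart x₁ (P.retr q) = P.localChart x₁ q := by
  change (chartAt (𝔼 n) x₁ q.1, leftInv (P.frameAt x₁ q.1) (P.proj q.1 q.2)) = _
  rw [leftInv_frameAt_proj]
  rfl

/-- `bchart x₁ = Ψ_{x₁} ∘ incl`. [folklore] -/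
theorem bchart_eq_localChart_incl (x₁ : M) (p : P.Total) :
    P.bchart x₁ p = P.localChart x₁ (P.incl p) := by
  rw [← bchart_retr, retr_incl]

/-- `Ψ_{x₁}` is `C^∞` over the good set of `x₁`. [folklore] -/
theorem contMDiffOn_localChart [IsManifold (𝓡 n) ∞ M] (x₁ : M) :
    ContMDiffOn ((𝓡 n).prod (𝓡 m)) 𝓘(ℝ, 𝔼 n × 𝔼 k) ∞ (P.localChart x₁)
      (Prod.fst ⁻¹' P.goodSet x₁) := by
  have h1 : ContMDiffOn ((𝓡 n).prod (𝓡 m)) (𝓡 n) ∞ (fun q : M × 𝔼 m => chartAt (𝔼 n) x₁ q.1)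
      (Prod.fst ⁻¹' P.goodSet x₁) :=
    (contMDiffOn_chart (x := x₁)).comp contMDiff_fst.contMDiffOn fun _ hq => hq.1
  have h2 : ContMDiffOn ((𝓡 n).prod (𝓡 m)) 𝓘(ℝ, 𝔼 m →L[ℝ] 𝔼 k) ∞
      (fun q : M × 𝔼 m => leftInv (P.frameAt x₁ q.1)) (Prod.fst ⁻¹' P.goodSet x₁) := by
    intro q hq
    have ha : ContDiffAt ℝ ∞ (leftInv : (𝔼 k →L[ℝ] 𝔼 m) → 𝔼 m →L[ℝ] 𝔼 k)
        (P.frameAt x₁ q.1) := contDiffAt_leftInv hq.2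
    have hb : ContMDiffAt ((𝓡 n).prod (𝓡 m)) 𝓘(ℝ, 𝔼 k →L[ℝ] 𝔼 m) ∞
        (fun q : M × 𝔼 m => P.frameAt x₁ q.1) q :=
      ((P.contMDiff_frameAt x₁).comp contMDiff_fst) q
    exact (ContDiffAt.comp_contMDiffAt (f := fun q : M × 𝔼 m => P.frameAt x₁ q.1) (x := q)
      ha hb).contMDiffWithinAt
  exact h1.prodMk_space (h2.clm_apply contMDiff_snd.contMDiffOn)

/-! ### The total space is a `C^∞` manifold -/

/-- **The total space `E(P)` is a `C^∞` manifold** (charted on `ℝⁿ × ℝᵏ`, self-model): the chart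
changes `(bchart x₀)⁻¹ ≫ bchart x₁ = Ψ_{x₁} ∘ Φ_{x₀}` are `C^∞`. [cite: HirschDT1976, Ch. 4 §1] -/
instance isManifold [IsManifold (𝓡 n) ∞ M] : IsManifold 𝓘(ℝ, 𝔼 n × 𝔼 k) ∞ P.Total := by
  refine isManifold_of_contDiffOn _ _ _ ?_
  rintro _ _ ⟨x₀, rfl⟩ ⟨x₁, rfl⟩
  have hsrc : ∀ q, q ∈ ((P.bchart x₀).symm ≫ₕ P.bchart x₁).source ↔
      q ∈ (P.bchart x₀).target ∧ (P.bchart x₀).symm q ∈ (P.bchart x₁).source := fun q => by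
    rw [OpenPartialHomeomorph.trans_source, OpenPartialHomeomorph.symm_source, mem_inter_iff,
      mem_preimage]
  have hsub1 : ((P.bchart x₀).symm ≫ₕ P.bchart x₁).source ⊆
      Prod.fst ⁻¹' (chartAt (𝔼 n) x₀).target := fun q hq => by
    rw [hsrc] at hq
    exact hq.1.1
  have hsub2 : ((P.bchart x₀).symm ≫ₕ P.bchart x₁).source ⊆
      P.localParam x₀ ⁻¹' (Prod.fst ⁻¹' P.goodSet x₁) := fun q hq => by
    rw [hsrc] at hq
    exact hq.2
  have h : ContMDiffOn 𝓘(ℝ, 𝔼 n × 𝔼 k) 𝓘(ℝ, 𝔼 n × 𝔼 k) ∞ (P.localChart x₁ ∘ P.localParam x₀)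
      ((P.bchart x₀).symm ≫ₕ P.bchart x₁).source :=
    (P.contMDiffOn_localChart x₁).comp ((P.contMDiffOn_localParam x₀).mono hsub1) hsub2
  have h' : ContDiffOn ℝ ∞ (P.localChart x₁ ∘ P.localParam x₀)
      ((P.bchart x₀).symm ≫ₕ P.bchart x₁).source := contMDiffOn_iff_contDiffOn.1 h
  simp only [modelWithCornersSelf_coe, modelWithCornersSelf_coe_symm, CompTriple.comp_eq, range_id,
    inter_univ, preimage_id_eq, id_eq]
  refine h'.congr fun q _ => ?_
  rw [OpenPartialHomeomorph.coe_trans, Function.comp_apply, Function.comp_apply,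
    bchart_eq_localChart_incl, incl_bchart_symm]

section Smooth

variable [IsManifold (𝓡 n) ∞ M]

/-- **The retraction `(y, w) ↦ (y, P_y w)` is `C^∞`.** [folklore] -/
theorem contMDiff_retr : ContMDiff ((𝓡 n).prod (𝓡 m)) 𝓘(ℝ, 𝔼 n × 𝔼 k) ∞ P.retr := by
  intro q
  rw [contMDiffAt_iff_target]
  refine ⟨P.continuous_retr.continuousAt, ?_⟩
  have hq : q ∈ Prod.fst ⁻¹' P.goodSet q.1 := P.mem_goodSet_self q.1
  have h := (P.contMDiffOn_localChart q.1).contMDiffAt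
    (((P.isOpen_goodSet q.1).preimage continuous_fst).mem_nhds hq)
  refine h.congr_of_eventuallyEq (Filter.Eventually.of_forall fun q' => ?_)
  rw [Function.comp_apply, extChartAt_coe, Function.comp_apply, modelWithCornersSelf_coe, id_eq]
  exact P.bchart_retr q.1 q'

/-- **The inclusion `E(P) → M × ℝᵐ` is `C^∞`.** [folklore] -/
theorem contMDiff_incl : ContMDiff 𝓘(ℝ, 𝔼 n × 𝔼 k) ((𝓡 n).prod (𝓡 m)) ∞ P.incl := by
  intro p
  rw [contMDiffAt_iff_source]
  have hmem : P.bchart (P.base p) p ∈ (P.bchart (P.base p)).target :=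
    (P.bchart (P.base p)).map_source (mem_chart_source _ p)
  have h2 : ContMDiffAt 𝓘(ℝ, 𝔼 n × 𝔼 k) ((𝓡 n).prod (𝓡 m)) ∞ (P.localParam (P.base p))
      (P.bchart (P.base p) p) :=
    (P.contMDiffOn_localParam (P.base p)).contMDiffAt
      (((chartAt (𝔼 n) (P.base p)).open_target.preimage continuous_fst).mem_nhds hmem.1)
  have hfun : P.incl ∘ (extChartAt 𝓘(ℝ, 𝔼 n × 𝔼 k) p).symm = P.localParam (P.base p) := by
    funext q
    rw [Function.comp_apply, extChartAt_coe_symm, Function.comp_apply,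
      modelWithCornersSelf_coe_symm, id_eq]
    rfl
  have hpt : extChartAt 𝓘(ℝ, 𝔼 n × 𝔼 k) p p = P.bchart (P.base p) p := by
    rw [extChartAt_coe, Function.comp_apply, modelWithCornersSelf_coe, id_eq]
    rfl
  rw [hfun, hpt]
  exact h2.contMDiffWithinAt

/-- The bundle projection is `C^∞`. [folklore] -/
theorem contMDiff_base : ContMDiff 𝓘(ℝ, 𝔼 n × 𝔼 k) (𝓡 n) ∞ P.base := contMDiff_fst.comp P.contMDiff_incl

/-- The vector part is `C^∞`. [folklore] -/
theorem contMDiff_vec : ContMDiff 𝓘(ℝ, 𝔼 n × 𝔼 k) (𝓡 m) ∞ P.vec := contMDiff_snd.comp P.contMDiff_incl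

/-- The zero section is `C^∞`. [folklore] -/
theorem contMDiff_zero : ContMDiff (𝓡 n) 𝓘(ℝ, 𝔼 n × 𝔼 k) ∞ P.zero := by
  rw [zero_eq_retr_comp]
  exact P.contMDiff_retr.comp (contMDiff_id.prodMk contMDiff_const)

end Smooth

end ProjBundle

end Literature.Topology.Immersions
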